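import Summits.QuantumAdvantage.QuantumAdvantage.Theorems.HankelLiftBeyondRectanglesUniform
import HarnessLib

/-!
# Route HankelLift, crux `BeyondRectangles` (stmt-QuantumAdvantage-18440): the efficiency hypothesis of the
# residual statements is load-bearing

Sanity theorems for the two route-posited open hypotheses `LiouvilleBPPDark` (`HankelLiftBeyondRectanglesDefs.lean`)
and `UniformLiouvilleBPPDark` (`HankelLiftBeyondRectanglesUniform.lean`): dropping the binder
`B.IsPolyTime id encodeBool` makes each of them FALSE, witnessed by the truth-table algorithm
`truthTable = RandAlg.ofDet (w ↦ [λ(val w + 2) = −1])` (no coins), whose correlation with `λ(m + 2)` is exactly `−1`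
per integer: `uniformCorr truthTable n = −2ⁿ⁺¹` and `sumCorr truthTable n = −4ⁿ` at EVERY level `n`.  So the
darkness statements are genuinely about EFFICIENT observers (as the refuter's `beyondRectangles_false_without_PPT`
recorded for the crux itself, evidence 2026-08-17), and the constants `1/12`, `1/6` are not vacuous.

WHAT THIS IS NOT: says nothing about PPT observers; `LiouvilleBPPDark` / `UniformLiouvilleBPPDark` stay open.
-/

-- the sub-problem namespace `Summit.QuantumAdvantage.QuantumAdvantage` repeats the summit name by design (D-0017)
set_option linter.dupNamespace false

noncomputable section

namespace Summit.QuantumAdvantage.QuantumAdvantage.Theorems.BeyondRectangles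

open scoped BigOperators Classical
open Literature.Computability.Complexity

/-- **The truth-table observer** (no coins, not efficient): `w ↦ [λ(val w + 2) = −1]`. [folklore] -/
def truthTable : RandAlg (List Bool) Bool :=
  RandAlg.ofDet fun w => decide (ArithmeticFunction.liouville (bitsToNat w + 2) = -1)

/-- The truth-table observer anti-correlates perfectly: `λ(m+2)·(2·Pr[truthTable(encSum n m) = true] − 1) = −1`
for `m < 2ⁿ⁺¹`. [folklore] -/
theorem liouville_mul_truthTable {n m : ℕ} (hm : m < 2 ^ (n + 1)) :
    ((ArithmeticFunction.liouville (m + 2) : ℤ) : ℝ) * (2 * truthTable.pr id (encSum n m) {true} - 1) = -1 := by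
  unfold truthTable
  rw [RandAlg.pr_ofDet, bitsToNat_encSum hm]
  have hl : ArithmeticFunction.liouville (m + 2) = 1 ∨ ArithmeticFunction.liouville (m + 2) = -1 := by
    rw [ArithmeticFunction.liouville_apply (show m + 2 ≠ 0 by omega)]; exact neg_one_pow_eq_or ℤ _
  rcases hl with h | h
  · rw [h]; norm_num
  · rw [h]; norm_num

/-- `uniformCorr truthTable n = −2ⁿ⁺¹`. [folklore] -/
theorem uniformCorr_truthTable (n : ℕ) : uniformCorr truthTable n = -(2 : ℝ) ^ (n + 1) := by
  unfold uniformCorr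
  rw [Finset.sum_congr rfl fun m hm => liouville_mul_truthTable (Finset.mem_range.1 hm), Finset.sum_const,
    Finset.card_range, nsmul_eq_mul, mul_neg_one]
  push_cast
  ring

/-- `sumCorr truthTable n = −4ⁿ`. [folklore] -/
theorem sumCorr_truthTable (n : ℕ) : sumCorr truthTable n = -(4 : ℝ) ^ n := by
  unfold sumCorr
  have h : ∀ m ∈ Finset.range (2 ^ (n + 1)),
      (antidiag n m : ℝ) * ((ArithmeticFunction.liouville (m + 2) : ℤ) : ℝ) *
          (2 * truthTable.pr id (encSum n m) {true} - 1) = -(antidiag n m : ℝ) := by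
    intro m hm
    rw [mul_assoc, liouville_mul_truthTable (Finset.mem_range.1 hm), mul_neg_one]
  rw [Finset.sum_congr rfl h, Finset.sum_neg_distrib, sum_antidiag]

/-- **`UniformLiouvilleBPPDark` is false without the efficiency binder.** [folklore] -/
theorem not_uniformDark_without_polyTime :
    ¬ (∀ B : RandAlg (List Bool) Bool, ∃ᶠ n : ℕ in Filter.atTop, |uniformCorr B n| ≤ (2 : ℝ) ^ (n + 1) / 12) := by
  intro h
  have hfreq := h truthTable
  have hnever : ∀ᶠ n : ℕ in Filter.atTop, ¬ (|uniformCorr truthTable n| ≤ (2 : ℝ) ^ (n + 1) / 12) := by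
    refine Filter.Eventually.of_forall fun n => ?_
    rw [uniformCorr_truthTable, abs_neg, abs_of_pos (by positivity)]
    have : (0 : ℝ) < 2 ^ (n + 1) := by positivity
    linarith
  exact hfreq hnever

/-- **`LiouvilleBPPDark` is false without the efficiency binder.** [folklore] -/
theorem not_dark_without_polyTime :
    ¬ (∀ B : RandAlg (List Bool) Bool, ∃ᶠ n : ℕ in Filter.atTop, |sumCorr B n| ≤ (4 : ℝ) ^ n / 6) := by
  intro h
  have hfreq := h truthTable
  have hnever : ∀ᶠ n : ℕ in Filter.atTop, ¬ (|sumCorr truthTable n| ≤ (4 : ℝ) ^ n / 6) := by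
    refine Filter.Eventually.of_forall fun n => ?_
    rw [sumCorr_truthTable, abs_neg, abs_of_pos (by positivity)]
    have : (0 : ℝ) < 4 ^ n := by positivity
    linarith
  exact hfreq hnever

end Summit.QuantumAdvantage.QuantumAdvantage.Theorems.BeyondRectangles

end
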